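import Summits.CriticalPhenomena.PercolationContinuityZ3.Theorems.PercNearOneGluingNoHeavyLowerTailSunflowerC1FastCertificate
import HarnessLib

/-!
# `NoHeavyLowerTail` (crux stmt-CriticalPhenomena-4575), abstract sunflower cubic at LAW level: the CENSUS MACHINE — enumeration
# of all sunflowers on `n` coins (petals in key order, chunked by core size) and the soundness of one chunk

Support file (seat `prim-ineq-gen-2` gen 33; `--supports stmt-CriticalPhenomena-4575`).  No `sorry`, no computation in this file
(the compiled chunks for `n = 4` are …SunflowerC1FourCoinsChunk1–6, the assembly …SunflowerC1FourCoins).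

* `famOfMask`, `famKey`, `InsClosed` (decidable up-set test; `insClosed_of_isUpperSet`), `upFams n` (all insert-closed families by bit
  masks, with keys), `mkSun` (the sunflower of a valid triple), `sunTest`, `coreTest` (all triples over one core with
  `key V₀ ≤ key V₁ ≤ key V₂`), **`allSunTestCard n lo hi`** (all cores with `lo ≤ #core < hi`; index tables built once);
* **`c1_sorted_of_allSunTestCard`**: a passing chunk + completeness of `upFams n` ⟹ (C1) at every bias for every sunflower in the
  chunk whose petals are in key order;  the reordering (`swapPetals`, `c1_of_swap01/12/02`) and the order-free
  **`c1_of_allSunTestCard`** are in …SunflowerC1FastCensusPetals.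
-/

namespace Summit.CriticalPhenomena.PercolationContinuityZ3.Theorems.SunflowerPartition

namespace SafeCalc

namespace C1Cert

open Finset Bern

variable {n : ℕ}

/-! ## All sunflowers on `n` coins: enumeration (up to the order of the petals), the compiled check, and its soundness -/

/-- Binary index of a point `S ⊆ [n]`. [this work] -/
def ptIdx (S : Finset (Fin n)) : ℕ := ∑ i ∈ S, 2 ^ (i : ℕ)

/-- The family of points encoded by the bit mask `m`. [this work] -/
def famOfMask (n m : ℕ) : Finset (Finset (Fin n)) := univ.filter fun S => m.testBit (ptIdx S)

/-- The bit mask of a family (used only to ORDER the petals; any function would do). [this work] -/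
def famKey (V : Finset (Finset (Fin n))) : ℕ := ∑ S ∈ V, 2 ^ ptIdx S

/-- Closed under inserting single coordinates — the decidable form of "up-set" for families of finite sets. [this work] -/
def InsClosed (V : Finset (Finset (Fin n))) : Prop := ∀ S ∈ V, ∀ i : Fin n, insert i S ∈ V

/-- `InsClosed` is decidable. [this work] -/
instance instDecidableInsClosed (V : Finset (Finset (Fin n))) : Decidable (InsClosed V) := by
  unfold InsClosed; infer_instance

/-- An up-set is insert-closed (converse of `isUpperSet_of_insert_mem`). [this work] -/
theorem insClosed_of_isUpperSet {V : Finset (Finset (Fin n))} (h : IsUpperSet (V : Set (Finset (Fin n)))) : InsClosed V :=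
  fun S hS i => h (Finset.subset_insert i S) hS

/-- The intersection of two insert-closed families is insert-closed. [this work] -/
theorem InsClosed.inter {V W : Finset (Finset (Fin n))} (hV : InsClosed V) (hW : InsClosed W) : InsClosed (V ∩ W) :=
  fun S hS i => mem_inter.2 ⟨hV S (mem_inter.1 hS).1 i, hW S (mem_inter.1 hS).2 i⟩

/-- All insert-closed families of points of `[n]` with their keys, as a list (by bit masks; complete at `n = 4` by
`mem_upFams_four`). [this work] -/
def upFams (n : ℕ) : List (Finset (Finset (Fin n)) × ℕ) :=
  (((List.range (2 ^ (2 ^ n))).map (famOfMask n)).filter fun V => decide (InsClosed V)).map fun V => (V, famKey V)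

/-- The sunflower with up-sets `V₀, V₁, V₂` (insert-closed, common pairwise intersections). [this work] -/
def mkSun (V₀ V₁ V₂ : Finset (Finset (Fin n)))
    (h : (InsClosed V₀ ∧ InsClosed V₁ ∧ InsClosed V₂) ∧ (V₀ ∩ V₂ = V₀ ∩ V₁ ∧ V₁ ∩ V₂ = V₀ ∩ V₁)) : Sunflower (Fin n) where
  V := ![V₀, V₁, V₂]
  upper := by
    intro i
    fin_cases i
    · exact isUpperSet_of_insert_mem h.1.1
    · exact isUpperSet_of_insert_mem h.1.2.1
    · exact isUpperSet_of_insert_mem h.1.2.2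
  inter_eq := by
    intro i j hij
    fin_cases i <;> fin_cases j
    all_goals simp_all [Finset.inter_comm]

/-- The fast (C1) check of the triple `(V₀, V₁, V₂)` if it is a sunflower (vacuously `true` otherwise). [this work] -/
def sunTest (tb : Tabs n) (V₀ V₁ V₂ : Finset (Finset (Fin n))) : Bool :=
  if h : (InsClosed V₀ ∧ InsClosed V₁ ∧ InsClosed V₂) ∧ (V₀ ∩ V₂ = V₀ ∩ V₁ ∧ V₁ ∩ V₂ = V₀ ∩ V₁) then
    checkFast tb (mkSun V₀ V₁ V₂ h)
  else true

/-- The check of all sunflowers with CORE `a` and petals in increasing key order: all `V₀, V₁, V₂ ⊇ a` from `U` with pairwise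
intersections `a` and `key V₀ ≤ key V₁ ≤ key V₂`. [this work] -/
def coreTest (tb : Tabs n) (U : List (Finset (Finset (Fin n)) × ℕ)) (a : Finset (Finset (Fin n))) : Bool :=
  let Ua := U.filter fun p => decide (a ⊆ p.1)
  Ua.all fun p₀ => Ua.all fun p₁ =>
    !decide (p₀.2 ≤ p₁.2 ∧ p₀.1 ∩ p₁.1 = a) ||
      Ua.all fun p₂ => !decide (p₁.2 ≤ p₂.2 ∧ p₀.1 ∩ p₂.1 = a ∧ p₁.1 ∩ p₂.1 = a) || sunTest tb p₀.1 p₁.1 p₂.1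

/-- **The check over all sunflowers on `n` coins (petals in key order) whose core has between `lo` and `hi − 1` points** — one
chunk of the census; the index tables are built once. [this work] -/
def allSunTestCard (n lo hi : ℕ) : Bool :=
  let tb := mkTabs n
  let U := upFams n
  (U.filter fun p => decide (lo ≤ p.1.card ∧ p.1.card < hi)).all fun p => coreTest tb U p.1

/-- Two sunflowers with the same up-sets are equal. [this work] -/
theorem sunflower_eq_of_V_eq {F G : Sunflower (Fin n)} (h : F.V = G.V) : F = G := by
  cases F; cases G; cases h; rfl

/-- **Soundness of one chunk, sorted case**: if the chunk `[lo, hi)` passes and the enumeration is complete, then (C1) holds at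
every bias for every sunflower on `n` coins whose core has between `lo` and `hi − 1` points and whose petals are in key order.
[this work] -/
theorem c1_sorted_of_allSunTestCard {lo hi : ℕ} (hall : allSunTestCard n lo hi = true)
    (hcomp : ∀ V : Finset (Finset (Fin n)), InsClosed V → (V, famKey V) ∈ upFams n)
    (F : Sunflower (Fin n)) (hcard : lo ≤ (F.V 0 ∩ F.V 1).card ∧ (F.V 0 ∩ F.V 1).card < hi)
    (hk01 : famKey (F.V 0) ≤ famKey (F.V 1)) (hk12 : famKey (F.V 1) ≤ famKey (F.V 2))
    (x : Fin n → ℝ) (hx : ∀ i, 0 ≤ x i ∧ x i ≤ 1) :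
    cellMass F 1 x * cellMass F 2 x * cellMass F 3 x ≤
      max (cellMass F 4 x) (cellMass F 0 x) *
        (cellMass F 4 x * cellMass F 0 x
          - (cellMass F 1 x * cellMass F 2 x + cellMass F 1 x * cellMass F 3 x + cellMass F 2 x * cellMass F 3 x)) := by
  have h0 : InsClosed (F.V 0) := insClosed_of_isUpperSet (F.upper 0)
  have h1 : InsClosed (F.V 1) := insClosed_of_isUpperSet (F.upper 1)
  have h2 : InsClosed (F.V 2) := insClosed_of_isUpperSet (F.upper 2)
  have h02 : F.V 0 ∩ F.V 2 = F.V 0 ∩ F.V 1 := F.inter_eq 0 2 (by decide)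
  have h12 : F.V 1 ∩ F.V 2 = F.V 0 ∩ F.V 1 := F.inter_eq 1 2 (by decide)
  have haU : (F.V 0 ∩ F.V 1, famKey (F.V 0 ∩ F.V 1)) ∈ upFams n := hcomp _ (h0.inter h1)
  have hsub0 : F.V 0 ∩ F.V 1 ⊆ F.V 0 := inter_subset_left
  have hsub1 : F.V 0 ∩ F.V 1 ⊆ F.V 1 := inter_subset_right
  have hsub2 : F.V 0 ∩ F.V 1 ⊆ F.V 2 := h02 ▸ inter_subset_right
  have hm0 : (F.V 0, famKey (F.V 0)) ∈ (upFams n).filter fun p => decide (F.V 0 ∩ F.V 1 ⊆ p.1) :=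
    List.mem_filter.2 ⟨hcomp _ h0, by simp [hsub0]⟩
  have hm1 : (F.V 1, famKey (F.V 1)) ∈ (upFams n).filter fun p => decide (F.V 0 ∩ F.V 1 ⊆ p.1) :=
    List.mem_filter.2 ⟨hcomp _ h1, by simp [hsub1]⟩
  have hm2 : (F.V 2, famKey (F.V 2)) ∈ (upFams n).filter fun p => decide (F.V 0 ∩ F.V 1 ⊆ p.1) :=
    List.mem_filter.2 ⟨hcomp _ h2, by simp [hsub2]⟩
  have hcond : (InsClosed (F.V 0) ∧ InsClosed (F.V 1) ∧ InsClosed (F.V 2)) ∧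
      (F.V 0 ∩ F.V 2 = F.V 0 ∩ F.V 1 ∧ F.V 1 ∩ F.V 2 = F.V 0 ∩ F.V 1) := ⟨⟨h0, h1, h2⟩, h02, h12⟩
  have hcore : coreTest (mkTabs n) (upFams n) (F.V 0 ∩ F.V 1) = true := by
    simp only [allSunTestCard, List.all_eq_true] at hall
    exact hall _ (List.mem_filter.2 ⟨haU, by simp [hcard]⟩)
  have hst : sunTest (mkTabs n) (F.V 0) (F.V 1) (F.V 2) = true := by
    simp only [coreTest, List.all_eq_true] at hcore
    have h := hcore _ hm0 _ hm1
    rw [Bool.or_eq_true] at h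
    rcases h with h | h
    · simp [hk01] at h
    · rw [List.all_eq_true] at h
      have h' := h _ hm2
      rw [Bool.or_eq_true] at h'
      rcases h' with h' | h'
      · simp [h02, h12, hk12] at h'
      · exact h'
  have hcs : checkFast (mkTabs n) (mkSun (F.V 0) (F.V 1) (F.V 2) hcond) = true := by
    have := hst
    simp only [sunTest, hcond, and_self, dif_pos] at this
    exact this
  have hFG : mkSun (F.V 0) (F.V 1) (F.V 2) hcond = F := by
    apply sunflower_eq_of_V_eq
    funext i
    fin_cases i <;> rfl
  rw [hFG] at hcs
  exact c1_of_checkFast F hcs x hx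


end C1Cert

end SafeCalc

end Summit.CriticalPhenomena.PercolationContinuityZ3.Theorems.SunflowerPartition
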